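import Summits.HodgeConjecture.HodgeConjecture.Theorems.GenericDivisibilityGenericDivisibilityBoundedSupportedTop
import Literature.AlgebraicGeometry.HodgeTheory.SurjectivePullbackAlgebraicClasses
import HarnessLib

/-!
# Route GenericDivisibility — crux C2 `GenericDivisibilityBounded` (stmt-HodgeConjecture-18467):
# small structure lemmas of the heart of line `finite-level-bootstrap`

Lead c4 (cycle 6). Sorry-free, definition-free; notation as in `…LevelCleanFunnel` (`D'(m, z)`:
`∃ Z` closed `≠ univ`, `∃ y`, `∃ M ≥ 1`, `M • (z| - m • y) = 0`; "level `ℓ^s` CLEAN in degree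
`k`": `∀ z, D'(ℓ^s, z) → ∃ w, z - ℓ • w ∈ GT`).

* `genericDivisibilityBounded_divisibleUpToTorsion_of_mul` — `D'(m c, z) ⇒ D'(m, z)`;
* `genericDivisibilityBounded_levelClean_mono` — a clean level stays clean higher up:
  `LevelClean ℓ s ⇒ LevelClean ℓ s'` for `s ≤ s'` (so the heart "∃ s" is a statement about all
  large `s`, and refuting it at `X` and `ℓ` means refuting EVERY level);
* `genericDivisibilityBounded_exists_levelClean_iff_boundedLoss` — the heart at `ℓ` ⟺ BOUNDED
  `ℓ`-ADIC LOSS: `∃ s ≥ 1, ∀ n z, D'(ℓ^{n+s}, z) ⇒ z ∈ ℓ^{n+1} H + GT` (→ is the landed bootstrap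
  `genericDivisibilityBounded_bootstrap`, ← is `n = 0`);
* `genericDivisibilityBounded_mem_GT_of_mem_coniveauFiltration_int` — integral coniveau `≥ 1`
  (`Motives.coniveauFiltration ℤ X k 1`) implies generically torsion (`N = 1`);
* `genericDivisibilityBounded_supportedClasses_eq_top_of_surjective`,
  `genericDivisibilityBounded_levelClean_of_surjective_of_supportedClasses_eq_top` — the `N¹ = ⊤`
  sector is inherited by everything DOMINATED by it: if `f : X' ⟶ X` is a surjective morphism of
  smooth projective `n`-folds and `N¹Hᵏ(X') = Hᵏ(X')` then `N¹Hᵏ(X) = Hᵏ(X)`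
  (`mem_supportedClasses_of_map_mem_of_surjective`: `x = c⁻¹ f_* f^* x`), hence the heart at every
  `(ℓ, s)` and C2 hold at `X` (quotients `(S × Y)/G`, images of products with a `p_g = 0` factor, …).

References: [HatcherAT2002] §3.1; [VoisinHodgeI2002] §7.3.2 Rem. 7.29; [BlochOgus1974ENS] (3.8).
-/

set_option linter.dupNamespace false

noncomputable section

namespace Summit.HodgeConjecture.HodgeConjecture.Theorems

open CategoryTheory AlgebraicGeometry
open Literature.AlgebraicGeometry.Motives Literature.AlgebraicGeometry.HodgeTheory
  Literature.AlgebraicTopology.SingularHomology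
open Summit.HodgeConjecture.HodgeConjecture.Theses.GenericDivisibility

/-- Restriction `H^k(X(ℂ);ℤ) → H^k((X∖Z)(ℂ);ℤ)`, the very term of the route decls (notation only). -/
local notation3 (prettyPrint := false) "Res[" X ", " Z ", " k "]" =>
  singularCohomology.map ℤ ℤ
    (⟨Subtype.val, continuous_subtype_val⟩ : C(complexPointsCompl X Z, ComplexPoints X)) k

/-! ### Monotonicity in the modulus and in the level -/

/-- `D'(m c, z) ⇒ D'(m, z)`: divisibility by `m c` up to torsion on an open gives divisibility by
`m` on the same open (`y ↦ c • y`). [cite: HatcherAT2002, §3.1] -/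
theorem genericDivisibilityBounded_divisibleUpToTorsion_of_mul {X : SchemeOver ℂ} {k m c : ℕ}
    {z : singularCohomology ℤ ℤ (ComplexPoints X) k}
    (hz : ∃ Z : Set X.left, IsClosed Z ∧ Z ≠ Set.univ ∧
      ∃ (y : singularCohomology ℤ ℤ (complexPointsCompl X Z) k) (M : ℕ), 1 ≤ M ∧
        M • (Res[X, Z, k] z - (m * c) • y) = 0) :
    ∃ Z : Set X.left, IsClosed Z ∧ Z ≠ Set.univ ∧
      ∃ (y : singularCohomology ℤ ℤ (complexPointsCompl X Z) k) (M : ℕ), 1 ≤ M ∧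
        M • (Res[X, Z, k] z - m • y) = 0 := by
  obtain ⟨Z, hZ, hZne, y, M, hM, h⟩ := hz
  exact ⟨Z, hZ, hZne, c • y, M, hM, by rwa [← mul_smul]⟩

/-- **A clean level stays clean higher up**: if level `ℓ^s` is clean in degree `k` then so is
every level `ℓ^{s'}`, `s ≤ s'` (`D'(ℓ^{s'}, z) ⇒ D'(ℓ^s, z)`). So the heart "some level is clean" is
a statement about all sufficiently deep levels, and refuting it at `(X, ℓ)` means refuting every
level. [cite: HatcherAT2002, §3.1] -/
theorem genericDivisibilityBounded_levelClean_mono {X : SchemeOver ℂ} {k ℓ s s' : ℕ} (hss' : s ≤ s')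
    (hclean : ∀ z : singularCohomology ℤ ℤ (ComplexPoints X) k,
      (∃ Z : Set X.left, IsClosed Z ∧ Z ≠ Set.univ ∧
        ∃ (y : singularCohomology ℤ ℤ (complexPointsCompl X Z) k) (M : ℕ), 1 ≤ M ∧
          M • (Res[X, Z, k] z - ℓ ^ s • y) = 0) →
      ∃ w : singularCohomology ℤ ℤ (ComplexPoints X) k, ∃ Z : Set X.left, IsClosed Z ∧
        Z ≠ Set.univ ∧ ∃ N : ℕ, 1 ≤ N ∧ N • Res[X, Z, k] (z - ℓ • w) = 0) :
    ∀ z : singularCohomology ℤ ℤ (ComplexPoints X) k,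
      (∃ Z : Set X.left, IsClosed Z ∧ Z ≠ Set.univ ∧
        ∃ (y : singularCohomology ℤ ℤ (complexPointsCompl X Z) k) (M : ℕ), 1 ≤ M ∧
          M • (Res[X, Z, k] z - ℓ ^ s' • y) = 0) →
      ∃ w : singularCohomology ℤ ℤ (ComplexPoints X) k, ∃ Z : Set X.left, IsClosed Z ∧
        Z ≠ Set.univ ∧ ∃ N : ℕ, 1 ≤ N ∧ N • Res[X, Z, k] (z - ℓ • w) = 0 := by
  intro z hz
  refine hclean z (genericDivisibilityBounded_divisibleUpToTorsion_of_mul (c := ℓ ^ (s' - s)) ?_)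
  rwa [← pow_add, Nat.add_sub_cancel' hss']

/-- **The heart at `ℓ` ⟺ bounded `ℓ`-adic loss.** On a smooth projective `X`, in degree `k`, for
`ℓ ≥ 1`: some level `ℓ^s` (`s ≥ 1`) is clean iff for some `s ≥ 1` and EVERY `n`,
`D'(ℓ^{n+s}, z) ⇒ ∃ w, z - ℓ^{n+1} • w ∈ GT` ("dividing by `ℓ^{n+s}` generically costs at most `s - 1`
powers of `ℓ` globally, uniformly in `n`"). `→` is the bootstrap `genericDivisibilityBounded_bootstrap`
(pure algebra on the directed non-empty opens), `←` is `n = 0`. [cite: HatcherAT2002, §3.1] -/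
theorem genericDivisibilityBounded_exists_levelClean_iff_boundedLoss {n₀ : ℕ} {X : SchemeOver ℂ}
    (hX : IsSmoothProjective n₀ X) (k : ℕ) {ℓ : ℕ} (hℓ : 1 ≤ ℓ) :
    (∃ s : ℕ, 1 ≤ s ∧ ∀ z : singularCohomology ℤ ℤ (ComplexPoints X) k,
      (∃ Z : Set X.left, IsClosed Z ∧ Z ≠ Set.univ ∧
        ∃ (y : singularCohomology ℤ ℤ (complexPointsCompl X Z) k) (M : ℕ), 1 ≤ M ∧
          M • (Res[X, Z, k] z - ℓ ^ s • y) = 0) →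
      ∃ w : singularCohomology ℤ ℤ (ComplexPoints X) k, ∃ Z : Set X.left, IsClosed Z ∧
        Z ≠ Set.univ ∧ ∃ N : ℕ, 1 ≤ N ∧ N • Res[X, Z, k] (z - ℓ • w) = 0) ↔
    (∃ s : ℕ, 1 ≤ s ∧ ∀ (n : ℕ) (z : singularCohomology ℤ ℤ (ComplexPoints X) k),
      (∃ Z : Set X.left, IsClosed Z ∧ Z ≠ Set.univ ∧
        ∃ (y : singularCohomology ℤ ℤ (complexPointsCompl X Z) k) (M : ℕ), 1 ≤ M ∧
          M • (Res[X, Z, k] z - ℓ ^ (n + s) • y) = 0) →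
      ∃ w : singularCohomology ℤ ℤ (ComplexPoints X) k, ∃ Z : Set X.left, IsClosed Z ∧
        Z ≠ Set.univ ∧ ∃ N : ℕ, 1 ≤ N ∧ N • Res[X, Z, k] (z - ℓ ^ (n + 1) • w) = 0) := by
  constructor
  · rintro ⟨s, hs, hclean⟩
    exact ⟨s, hs, fun n z hz ↦ genericDivisibilityBounded_bootstrap hX k ℓ s hℓ hclean n z hz⟩
  · rintro ⟨s, hs, hloss⟩
    refine ⟨s, hs, fun z hz ↦ ?_⟩
    obtain ⟨w, hw⟩ := hloss 0 z (by rwa [Nat.zero_add])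
    exact ⟨w, by rwa [Nat.zero_add, pow_one] at hw⟩

/-- **Registered sub-goal `stub_heartIffBoundedLoss` of stmt-HodgeConjecture-18467 (lead c4): the
heart at `ℓ` ⟺ bounded `ℓ`-adic loss**, verbatim (`genericDivisibilityBounded_exists_levelClean_iff_boundedLoss`).
[cite: HatcherAT2002, §3.1] -/
theorem stub_heartIffBoundedLoss : ∀ ⦃n₀ : ℕ⦄ ⦃X : SchemeOver ℂ⦄, IsSmoothProjective n₀ X → ∀ (k ℓ : ℕ), 1 ≤ ℓ → ((∃ s : ℕ, 1 ≤ s ∧ ∀ z : singularCohomology ℤ ℤ (ComplexPoints X) k, (∃ Z : Set X.left, IsClosed Z ∧ Z ≠ Set.univ ∧ ∃ (y : singularCohomology ℤ ℤ (complexPointsCompl X Z) k) (M : ℕ), 1 ≤ M ∧ M • (singularCohomology.map ℤ ℤ (⟨Subtype.val, continuous_subtype_val⟩ : C(complexPointsCompl X Z, ComplexPoints X)) k z - ℓ ^ s • y) = 0) → ∃ w : singularCohomology ℤ ℤ (ComplexPoints X) k, ∃ Z : Set X.left, IsClosed Z ∧ Z ≠ Set.univ ∧ ∃ N : ℕ,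 1 ≤ N ∧ N • singularCohomology.map ℤ ℤ (⟨Subtype.val, continuous_subtype_val⟩ : C(complexPointsCompl X Z, ComplexPoints X)) k (z - ℓ • w) = 0) ↔ (∃ s : ℕ, 1 ≤ s ∧ ∀ (n : ℕ) (z : singularCohomology ℤ ℤ (ComplexPoints X) k), (∃ Z : Set X.left, IsClosed Z ∧ Z ≠ Set.univ ∧ ∃ (y : singularCohomology ℤ ℤ (complexPointsCompl X Z) k) (M : ℕ), 1 ≤ M ∧ M • (singularCohomology.map ℤ ℤ (⟨Subtype.val, continuous_subtype_val⟩ : C(complexPointsCompl X Z, ComplexPoints X)) k z - ℓ ^ (n + s) • y) = 0) → ∃ w : singularCohomology ℤ ℤ (ComplexPoints X) k, ∃ Z : Set X.left, IsClosed Z ∧ Z ≠ Set.univ ∧ ∃ N : ℕ, 1 ≤ N ∧ N • singularCohomology.map ℤ ℤ (⟨Subtype.val, continuous_subtype_val⟩ : C(complexPointsCompl X Z, ComplexPoints X)) k (z - ℓ ^ (n + 1) • w) = 0)) :=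
  fun _ _ hX k _ hℓ ↦ genericDivisibilityBounded_exists_levelClean_iff_boundedLoss hX k hℓ

/-! ### Integral coniveau `≥ 1` is generically torsion -/

/-- A class of INTEGRAL coniveau `≥ 1` (`Motives.coniveauFiltration ℤ X k 1`: dies off one closed
subset of codimension `≥ 1`, integrally) is generically torsion with `N = 1`, on an irreducible `X`.
(The converse holds up to the torsion of the generic cohomology: granted Colliot-Thélène–Voisin's
torsion-freeness, `GT` is the saturation of `N¹_ℤ`.) [cite: BlochOgus1974ENS, (3.8)] -/
theorem genericDivisibilityBounded_mem_GT_of_mem_coniveauFiltration_int {X : SchemeOver ℂ}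
    [IrreducibleSpace X.left] {k : ℕ} {z : singularCohomology ℤ ℤ (ComplexPoints X) k}
    (hz : z ∈ coniveauFiltration ℤ X k 1) :
    ∃ Z : Set X.left, IsClosed Z ∧ Z ≠ Set.univ ∧ ∃ N : ℕ, 1 ≤ N ∧ N • Res[X, Z, k] z = 0 := by
  obtain ⟨Z, hZ, hcod, h0⟩ := (mem_coniveauFiltration_iff_exists ℤ k).1 hz
  refine ⟨Z, hZ, (forall_one_le_coheight_iff_ne_univ hZ).1 (fun t ht ↦ by exact_mod_cast hcod t ht),
    1, le_rfl, ?_⟩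
  rw [one_smul]
  exact h0

/-! ### The `N¹ = ⊤` sector is inherited by everything it dominates -/

/-- **`N¹Hᵏ = Hᵏ` descends along surjective morphisms of smooth projective `n`-folds**: if
`f : X' ⟶ X` is surjective and `supportedClasses X' k 1 = ⊤` then `supportedClasses X k 1 = ⊤`
(`x = c⁻¹ • f_*(f^* x)` and Gysin images keep their coniveau, the tree's
`mem_supportedClasses_of_map_mem_of_surjective`). [cite: VoisinHodgeI2002, §7.3.2 Remark 7.29] -/
theorem genericDivisibilityBounded_supportedClasses_eq_top_of_surjective {n : ℕ} {X' X : SchemeOver ℂ}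
    (hX' : IsSmoothProjective n X') (hX : IsSmoothProjective n X) (f : X' ⟶ X)
    (hf : Function.Surjective f.left.base) {k : ℕ} (htop : supportedClasses X' k 1 = ⊤) :
    supportedClasses X k 1 = ⊤ := by
  haveI : AlgebraicGeometry.Surjective f.left := ⟨hf⟩
  exact eq_top_iff.2 fun x _ ↦
    mem_supportedClasses_of_map_mem_of_surjective hX' hX f (htop ▸ Submodule.mem_top)

/-- **The heart at every `(ℓ, s)`, in degree `k ≥ 1`, on a smooth projective `X` DOMINATED by a
smooth projective `X'` of the same dimension with `N¹Hᵏ(X'(ℂ);ℂ) = Hᵏ(X'(ℂ);ℂ)`** (e.g. quotients and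
images of `S × Y` with `p_g(S) = 0`): `N¹ = ⊤` descends, then the `N¹ = ⊤` sector of the heart
(`genericDivisibilityBounded_levelClean_of_supportedClasses_eq_top`).
[cite: VoisinHodgeI2002, §7.3.2 Remark 7.29] [cite: BlochOgus1974ENS, (3.8)] -/
theorem genericDivisibilityBounded_levelClean_of_surjective_of_supportedClasses_eq_top {n : ℕ}
    {X' X : SchemeOver ℂ} (hX' : IsSmoothProjective n X') (hX : IsSmoothProjective n X) (f : X' ⟶ X)
    (hf : Function.Surjective f.left.base) {k : ℕ} (hk : 1 ≤ k) (htop : supportedClasses X' k 1 = ⊤)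
    (ℓ s : ℕ) :
    ∀ z : singularCohomology ℤ ℤ (ComplexPoints X) k,
      (∃ Z : Set X.left, IsClosed Z ∧ Z ≠ Set.univ ∧
        ∃ (y : singularCohomology ℤ ℤ (complexPointsCompl X Z) k) (M : ℕ), 1 ≤ M ∧
          M • (Res[X, Z, k] z - ℓ ^ s • y) = 0) →
      ∃ w : singularCohomology ℤ ℤ (ComplexPoints X) k, ∃ Z : Set X.left, IsClosed Z ∧
        Z ≠ Set.univ ∧ ∃ N : ℕ, 1 ≤ N ∧ N • Res[X, Z, k] (z - ℓ • w) = 0 :=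
  genericDivisibilityBounded_levelClean_of_supportedClasses_eq_top hX hk
    (genericDivisibilityBounded_supportedClasses_eq_top_of_surjective hX' hX f hf htop) ℓ s

/-- **C2 in degree `k` on a smooth projective `X` dominated by a smooth projective `X'` of the same
dimension with `N¹Hᵏ(X') = Hᵏ(X')`.** [cite: VoisinHodgeI2002, §7.3.2 Remark 7.29] -/
theorem genericDivisibilityBounded_at_of_surjective_of_supportedClasses_eq_top {n : ℕ}
    {X' X : SchemeOver ℂ} (hX' : IsSmoothProjective n X') (hX : IsSmoothProjective n X) (f : X' ⟶ X)
    (hf : Function.Surjective f.left.base) {k : ℕ} (htop : supportedClasses X' k 1 = ⊤) :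
    ∀ z : singularCohomology ℤ ℤ (ComplexPoints X) k,
      (∀ m : ℕ, 1 ≤ m → ∃ Z : Set X.left, IsClosed Z ∧ Z ≠ Set.univ ∧
        ∃ y : singularCohomology ℤ ℤ (complexPointsCompl X Z) k, m • y = Res[X, Z, k] z) →
      singularCohomology.ringChange (Int.castRingHom ℂ) (ComplexPoints X) k z ∈
        supportedClasses X k 1 :=
  genericDivisibilityBounded_at_of_supportedClasses_eq_top
    (genericDivisibilityBounded_supportedClasses_eq_top_of_surjective hX' hX f hf htop)

end Summit.HodgeConjecture.HodgeConjecture.Theorems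

end
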